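import Mathlib
import HarnessLib
import Literature.Geometry.Lorentzian.QuasiFinalStateDecomposition

/-!
# Route LogTimeThreeAnnuli · crux `DyadicCapture` · line `registered` — every point reaches late slabs

`lateReach_eventually_mem_causalPast_certifiedSlab` (registered helper stub): for a quasi final-state
decomposition `d : QuasiFinalStateDecomposition 𝓢 O k ε` with near-zone radii `R` whose charts are
causally exhaustive (for every chart time `τ₁ > τ₀`, `O ∖ certifiedLate R τ₁ ⊆ J⁻(certifiedSlab R τ₁)`),
EVERY point `p ∈ O` lies in the causal past of the certified slab at all sufficiently late chart times:
`∀ᶠ τ₁ in atTop, p ∈ J⁻(d.certifiedSlab R τ₁)`. This is the formal core of the causal-exhaustion step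
of Dafermos–Luk's Conjecture 1 (b) reading of the final state (closeness to Kerr in `J⁻(𝓘⁺)`).

Proof (elementary set/filter bookkeeping, no causal geometry):
* `Spacetime.IsLateChart.eventually_not_mem_image_lateRegion` — for ONE late chart `Ψ` (an open
  embedding, hence injective, on the late region `{t > τ₀}`), a fixed point `p` is eventually NOT in
  `Ψ '' {t > τ₁}`: if `p = Ψ x₀` with `t(x₀) > τ₀` then for `τ₁ ≥ max τ₀ t(x₀)` any late preimage of
  `p` equals `x₀` by injectivity, contradicting `t(x₀) ≤ τ₁`; if `p` has no late preimage, use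
  `{t > τ₁} ⊆ {t > τ₀}` for `τ₁ ≥ τ₀`.
* `lateReach_eventually_not_mem_certifiedLate` — combine the `N + 1` charts (`Filter.eventually_all`
  over `Fin d.N`), dropping the radius condition of the hole parts of `certifiedLate`.
* the registered stub — for `τ₁ > τ₀` with `p ∉ certifiedLate R τ₁`, exhaustion gives
  `p ∈ J⁻(certifiedSlab R τ₁)`.

Sources: Dafermos–Luk arXiv:1710.01722, Conjecture 1 (b); DHRT arXiv:2104.08222, §1 (late regions
`{t* ≥ τ₀}` of the reference charts); Klainerman, C. R. Mécanique 353 (2025), §1.1.1.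
-/

-- the `Summit.FinalStateConjecture.FinalStateConjecture.…` namespace repeats the summit = sub-problem
-- segment (D-0017 layout, CONVENTIONS §2); the duplicate is deliberate.
set_option linter.dupNamespace false

noncomputable section

namespace Summit.FinalStateConjecture.FinalStateConjecture.Theorems

open Literature.Geometry.Lorentzian
open scoped Topology Manifold ENNReal ContDiff
open Filter Set

/-- For a late-time chart `Ψ` (an open embedding of the late region `{t > τ₀}`, DHRT arXiv:2104.08222,
§1) and a fixed point `p` of the spacetime, `p` is eventually (in the chart time `τ₁ → ∞`) NOT in the
image `Ψ '' {t > τ₁}` of the late region after `τ₁`: a late preimage of `p` is unique by injectivity of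
`Ψ` on `{t > τ₀}`, and its time is eventually `≤ τ₁`. [folklore] -/
theorem eventually_not_mem_image_lateRegion {𝓢 : Spacetime.{0} 4} {B : ModelBackground}
    {𝒟 : Set 𝓢.carrier} {τ₀ : ℝ} {Ψ : B.domain → 𝓢.carrier} (hΨ : 𝓢.IsLateChart B 𝒟 τ₀ Ψ)
    (p : 𝓢.carrier) : ∀ᶠ τ₁ in atTop, p ∉ Ψ '' B.lateRegion τ₁ := by
  by_cases h : ∃ x₀ ∈ B.lateRegion τ₀, Ψ x₀ = p
  · obtain ⟨x₀, hx₀, rfl⟩ := h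
    filter_upwards [eventually_ge_atTop τ₀, eventually_ge_atTop (B.time x₀.1)] with τ₁ h₀ h₁
    rintro ⟨x, hx, hxp⟩
    have hx' : x ∈ B.lateRegion τ₀ := B.lateRegion_mono h₀ hx
    have hsub : (⟨x, hx'⟩ : B.lateRegion τ₀) = ⟨x₀, hx₀⟩ :=
      hΨ.isOpenEmbedding.injective (by simpa only [restrict_apply] using hxp)
    have hxx : x = x₀ := congrArg Subtype.val hsub
    subst hxx
    exact absurd (ModelBackground.mem_lateRegion.1 hx) (not_lt.2 h₁)
  · push Not at h
    filter_upwards [eventually_ge_atTop τ₀] with τ₁ h₀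
    rintro ⟨x, hx, hxp⟩
    exact h x (B.lateRegion_mono h₀ hx) hxp

/-- **Eventual uncertification of every point**: for a quasi final-state decomposition `d` with
near-zone radii `R`, a fixed point `p` of the spacetime is eventually (in the chart time `τ₁ → ∞`) NOT
in the certified late region `d.certifiedLate R τ₁` (flat chart image of `{x⁰ > τ₁}` plus the hole
charts' images of `{t*ᵢ > τ₁, rᵢ ≤ Rᵢ(t*ᵢ)}`): each of the `N + 1` late charts is injective on its
late region (`eventually_not_mem_image_lateRegion`), and `Fin d.N` is finite. Dafermos–Luk
arXiv:1710.01722, Conjecture 1 (b) (the certified exterior region). [folklore] -/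
theorem lateReach_eventually_not_mem_certifiedLate : ∀ (𝓢 : Spacetime.{0} 4) (O : Set 𝓢.carrier) (k : ℕ) (ε : ENNReal) (d : QuasiFinalStateDecomposition 𝓢 O k ε) (R : Fin d.N → ℝ → ℝ) (p : 𝓢.carrier), ∀ᶠ τ₁ in Filter.atTop, p ∉ d.certifiedLate R τ₁ := by
  intro 𝓢 O k ε d R p
  have hflat : ∀ᶠ τ₁ in atTop,
      p ∉ d.flatChart '' (Minkowski.backgroundOn d.flatDomain).lateRegion τ₁ :=
    eventually_not_mem_image_lateRegion d.isLateChart_flat p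
  have hholes : ∀ᶠ τ₁ in atTop, ∀ i, p ∉ d.chart i '' (d.background i).lateRegion τ₁ :=
    eventually_all.2 fun i ↦ eventually_not_mem_image_lateRegion (d.isLateChart i) p
  filter_upwards [hflat, hholes] with τ₁ h₁ h₂
  rw [QuasiFinalStateDecomposition.certifiedLate, mem_union, mem_iUnion, not_or, not_exists]
  exact ⟨h₁, fun i hi ↦ h₂ i (image_mono (fun x hx ↦ hx.1) hi)⟩

/-- **Every point of `O` causally reaches arbitrarily late certified slabs** (registered helper stub of
line `registered`, crux `DyadicCapture`): if the charts of `d` are causally exhaustive with radii `R`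
(for every chart time `τ₁ > τ₀`, `O ∖ d.certifiedLate R τ₁ ⊆ J⁻(d.certifiedSlab R τ₁)`), then every
`p ∈ O` lies in `J⁻(d.certifiedSlab R τ₁)` for all sufficiently late `τ₁` — since `p` is eventually
uncertified (`lateReach_eventually_not_mem_certifiedLate`). The causal-exhaustion reading of
Dafermos–Luk's formulation of the final state ("the geometry remains close to `g_{a₀,M₀}` in
`J⁻(𝓘⁺)`"). [cite: DafermosLuk2017, Conjecture 1 (b)] -/
theorem lateReach_eventually_mem_causalPast_certifiedSlab : ∀ (𝓢 : Spacetime.{0} 4) (O : Set 𝓢.carrier) (k : ℕ) (ε : ENNReal) (d : QuasiFinalStateDecomposition 𝓢 O k ε) (R : Fin d.N → ℝ → ℝ), (∀ τ₁ : ℝ, d.τ₀ < τ₁ → O \ d.certifiedLate R τ₁ ⊆ 𝓢.metric.causalPast 𝓢.timeOrientation (d.certifiedSlab R τ₁)) → ∀ p ∈ O, ∀ᶠ τ₁ in Filter.atTop, p ∈ 𝓢.metric.causalPast 𝓢.timeOrientation (d.certifiedSlab R τ₁) := by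
  intro 𝓢 O k ε d R hexh p hp
  filter_upwards [eventually_gt_atTop d.τ₀,
    lateReach_eventually_not_mem_certifiedLate 𝓢 O k ε d R p] with τ₁ hτ₁ hnot
  exact hexh τ₁ hτ₁ ⟨hp, hnot⟩

end Summit.FinalStateConjecture.FinalStateConjecture.Theorems

end
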